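import Summits.ResolutionOfSingularities.ResolutionOfSingularities.Theorems.JetCutBroadClasses
import Summits.ResolutionOfSingularities.ResolutionOfSingularities.Theorems.JetCutDegenerate2
import HarnessLib

/-!
# JetCutVastClasses — decomp-res node «JetCut» (lens-2 g15 rev 5)

Content VERBATIM from the decomp-res lens-2 file `HOME/decomp-res-lens-2/g15/JetCut.lean` rev 5 (pin 9f53e5ca =
`parts/JetCut-rev5-9f53e5ca.lean`, 7 495 l;
HOME = run/shared/lean/pub/decomp-res; CRITIC-LEDGER rows 109 / 115 / 120 / 121 / 122 / 127 / 133 CLEARED; landing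
order INBOX :231; the critic's
HYGIENE-landing.md h1–h11 applied — DOCSTRING-ONLY).  The lens's blocks RESTATED VERBATIM from lens-2 g12 / g13 /
g14 (§R / §R13 / §R14) are DELETED:
they are the tree's `RelativeDeltaCut*` / `CurveLeafExit*` / `PinchCut*` modules (namespaces `RelativeDeltaCut`,
`CurveLeafExit`, `PinchCut`, opened;
the lens's `CurveLeafExitRestated.x` / `PinchCutRestated.x` are cited as `CurveLeafExit.x` / `PinchCut.x`, the three
pointwise engine edges of g12 as
`RelativeDeltaCut.x`).  Namespace `…Theorems.JetCut` (the lens's `Theses.JetCut` is gate-reserved), sub-namespaces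
`Tame` / `Wide` / `Broad` / `Vast`
as in the lens; file split only (tree files ≤ 400 lines): sections, variables and every declaration exactly as in
the lens, the long rev-0/1 prose
lives in HOME/decomp-res-lens-2/g15/NODE-g15.md §ARCHIVE-A (not in the tree).  Node files, in import order:
`JetCutJetKernels`, `JetCutPoint`, `JetCutClasses`, `JetCutKernels`, `JetCutTame`, `JetCutTameClasses`,
`JetCutTameKernels`, `JetCutLadder`, `JetCutWideClasses`, `JetCutWideKernels`, `JetCutMixed`, `JetCutBroadClasses`,
`JetCutBroadKernels`, `JetCutDegenerate`, `JetCutVastClasses`, `JetCutVastKernels`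
(each possibly continued `…2`, `…3`), then the wiring `MaxContactCutJetCut*` (in the Theses cone).  All `--supports
stmt-ResolutionOfSingularities-29273`
(`MaxContactCut.RungOne`); nothing closes 29273 — decided cells carry their engines as hypotheses, and exactly ONE
located-residual aside is booked on
the route for this column (`Vast.VastSpecialRung`, home `JetCutVastClasses`).

§N4 (namespace `Vast`): the GRADED STATEMENTS of the VAST cut — `SeqVGen`, `SeqVSpec`, strata, `VGenRungAt`,
**`VastGenericRung`** (the DECIDED half, engines as hypotheses) / **`VastSpecialRung`** (THE LOCATED RESIDUAL of the
whole node at its outermost granularity — the ONE aside booked on the route for this column, superseding g14/g13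
residuals; docstring = the iff chain `Vast.jet/tame/wide/broadSpecialRung_iff_vastSpecialRung` modulo the decided
halves) — statement-only; this module is the cone-free aside home.

(Sources: HunekeSwanson2006 Cor. 5.5.5; CossartJannsenSaito2020 Ch. 2, Thm. 3.6/3.7, Ch. 8; CossartPiltant2008 Prop.
4.2; CossartPiltant2019 Rem. 3.2; Hironaka1964 Ch. III; Hironaka1967; Hironaka1977; Moh1987; Giraud1975.)
-/

open CategoryTheory AlgebraicGeometry TopologicalSpace IsLocalRing
open Literature.AlgebraicGeometry.Resolution
open Summit.ResolutionOfSingularities.ResolutionOfSingularities.Theorems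
open Summit.ResolutionOfSingularities.ResolutionOfSingularities.Theorems.WeakOrderReduction
open Summit.ResolutionOfSingularities.ResolutionOfSingularities.Theorems.DeltaFaceCutClasses
open Summit.ResolutionOfSingularities.ResolutionOfSingularities.Theorems.RelativeDeltaCut
open Summit.ResolutionOfSingularities.ResolutionOfSingularities.Theorems.CurveLeafExit
open Summit.ResolutionOfSingularities.ResolutionOfSingularities.Theorems.PinchCut

namespace Summit.ResolutionOfSingularities.ResolutionOfSingularities.Theorems.JetCut

namespace Vast

/-- **`SeqVSpec n`** — THE LOCATED CLASS: weak order reduction in dimension four at marking `n` for data having a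
VAST-SPECIAL core top point.  [UNDECIDED · IDEA-NEEDED · INSTRUMENTABLE T-jet / T-cone / T-uniform / T-round-bed.]
STATEMENT SCHEMA. (Sources: BierstoneGrigorievMilmanWlodarczyk2011 §3.1; CossartPiltant2019 Rem. 3.2; Moh1987.) -/
def SeqVSpec (n : ℕ) : Prop :=
  ∀ p : ℕ, p.Prime → ∀ (k : Type) [Field k] [CharP k p]
    (Y : Scheme.{0}) (g : Y ⟶ Spec (.of k)), IsSeparated g → LocallyOfFiniteType g → QuasiCompact g →
    ∀ hY : Scheme.IsRegular Y, topologicalKrullDim Y ≤ 4 →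
    ∀ I : Y.IdealSheafData, (∀ y : Y, idealOrder I y ≤ ((n : ℕ) : ℕ∞)) →
      (∃ y : Y, idealOrder I y = ((n : ℕ) : ℕ∞) ∧ IsVastSpecialPt g hY I n y) →
      ∃ t : CentreSeq Y, WeakResolution t (⟨I, [], n⟩ : MarkedIdeal Y)

/-- `SeqVSpecNonIso n` — NON-ISOLATED column of the located class.  WEAKER BY LETTER than g14's `SeqPSpecNonIso n`.
[UNDECIDED · sub-cut `seqVSpecNonIso_iff`.] (Sources: CossartJannsenSaito2020 Ch. 5; CossartPiltant2019 Rem. 3.2.) -/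
def SeqVSpecNonIso (n : ℕ) : Prop :=
  ∀ p : ℕ, p.Prime → ∀ (k : Type) [Field k] [CharP k p]
    (Y : Scheme.{0}) (g : Y ⟶ Spec (.of k)), IsSeparated g → LocallyOfFiniteType g → QuasiCompact g →
    ∀ hY : Scheme.IsRegular Y, topologicalKrullDim Y ≤ 4 →
    ∀ I : Y.IdealSheafData, (∀ y : Y, idealOrder I y ≤ ((n : ℕ) : ℕ∞)) →
      (∃ y : Y, idealOrder I y = ((n : ℕ) : ℕ∞) ∧ IsVastSpecialPt g hY I n y ∧
        ¬ FaceFormCutClasses.IsIsolatedTop I n y) →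
      ∃ t : CentreSeq Y, WeakResolution t (⟨I, [], n⟩ : MarkedIdeal Y)

/-- `SeqVSpecIso n` — ISOLATED column of the located class: vast-special core top points exist and every one of them is
isolated in the top locus (bed, in frame: the three binary towers; deep / power pinch near points after a section
package).  [UNDECIDED · INSTRUMENTABLE T-delta-tower.] (Sources: Hironaka1967; Moh1987.) -/
def SeqVSpecIso (n : ℕ) : Prop :=
  ∀ p : ℕ, p.Prime → ∀ (k : Type) [Field k] [CharP k p]
    (Y : Scheme.{0}) (g : Y ⟶ Spec (.of k)), IsSeparated g → LocallyOfFiniteType g → QuasiCompact g →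
    ∀ hY : Scheme.IsRegular Y, topologicalKrullDim Y ≤ 4 →
    ∀ I : Y.IdealSheafData, (∀ y : Y, idealOrder I y ≤ ((n : ℕ) : ℕ∞)) →
      (∃ y : Y, idealOrder I y = ((n : ℕ) : ℕ∞) ∧ IsVastSpecialPt g hY I n y) →
      (∀ y : Y, idealOrder I y = ((n : ℕ) : ℕ∞) → IsVastSpecialPt g hY I n y →
        FaceFormCutClasses.IsIsolatedTop I n y) →
      ∃ t : CentreSeq Y, WeakResolution t (⟨I, [], n⟩ : MarkedIdeal Y)

/-- `SeqVSpecCurve n` — CURVE stratum of the non-isolated column AFTER the vast leaf left: some non-isolated vast-special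
core top point lies on a clean curve.  WEAKER BY LETTER than g14's `SeqPSpecCurve n`.  [UNDECIDED · sub-cut
REGULAR/SINGULAR centre `seqVSpecCurve_iff_reg` · INSTRUMENTABLE T-jet / T-cone / T-uniform.] (Sources:
CossartJannsenSaito2020 Ch. 8–9; Narasimhan1983; CossartPiltant2008 Prop. 4.2.) -/
def SeqVSpecCurve (n : ℕ) : Prop :=
  ∀ p : ℕ, p.Prime → ∀ (k : Type) [Field k] [CharP k p]
    (Y : Scheme.{0}) (g : Y ⟶ Spec (.of k)), IsSeparated g → LocallyOfFiniteType g → QuasiCompact g →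
    ∀ hY : Scheme.IsRegular Y, topologicalKrullDim Y ≤ 4 →
    ∀ I : Y.IdealSheafData, (∀ y : Y, idealOrder I y ≤ ((n : ℕ) : ℕ∞)) →
      (∃ y : Y, idealOrder I y = ((n : ℕ) : ℕ∞) ∧ IsVastSpecialPt g hY I n y ∧
        ¬ FaceFormCutClasses.IsIsolatedTop I n y ∧ OnCleanCurve I n y) →
      ∃ t : CentreSeq Y, WeakResolution t (⟨I, [], n⟩ : MarkedIdeal Y)

/-- `SeqVSpecTangle n` — TANGLE stratum of the non-isolated column (Round material BY NAME 30458/30459/30460).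
[UNDECIDED · INSTRUMENTABLE T-round-bed.] (Sources: CossartJannsenSaito2020 Ch. 5; CossartPiltant2019 Rem. 3.2.) -/
def SeqVSpecTangle (n : ℕ) : Prop :=
  ∀ p : ℕ, p.Prime → ∀ (k : Type) [Field k] [CharP k p]
    (Y : Scheme.{0}) (g : Y ⟶ Spec (.of k)), IsSeparated g → LocallyOfFiniteType g → QuasiCompact g →
    ∀ hY : Scheme.IsRegular Y, topologicalKrullDim Y ≤ 4 →
    ∀ I : Y.IdealSheafData, (∀ y : Y, idealOrder I y ≤ ((n : ℕ) : ℕ∞)) →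
      (∃ y : Y, idealOrder I y = ((n : ℕ) : ℕ∞) ∧ IsVastSpecialPt g hY I n y ∧
        ¬ FaceFormCutClasses.IsIsolatedTop I n y) →
      (∀ y : Y, idealOrder I y = ((n : ℕ) : ℕ∞) → IsVastSpecialPt g hY I n y →
        ¬ FaceFormCutClasses.IsIsolatedTop I n y → ¬ OnCleanCurve I n y) →
      ∃ t : CentreSeq Y, WeakResolution t (⟨I, [], n⟩ : MarkedIdeal Y)

/-- `SeqVSpecCurveReg n` — REGULAR-CENTRE sub-stratum of the curve stratum = THE CELL g14 LOCATED (`SeqPSpecCurveReg`)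
CUT BY THE VAST LEAF (rev 5): some non-isolated vast-special core top point lies on a clean curve REGULAR at it.  What is
LEFT here after (J), (CT), (T), (L), (L′), (D): Top-isolated regular clean curves carrying a point that is in none of the
typed classes — principal tails whose lowest face has ≥ 2 monomials with a cancelling edge form (binary towers
`Π(z + αᵢu)`-type), NON-PRINCIPAL `I_y`, the `n ∣ k` purity jump after absorption (typed next target (D⁺): degenerate
vertex with `n ∣ k`, uniform along `C`), and curves failing uniformity / Top-isolation.  [UNDECIDED · IDEA-NEEDED ·
INSTRUMENTABLE T-jet / T-tame / T-deg-ladder.] (Sources: CossartJannsenSaito2020 Ch. 2, Ch. 8–9; CossartPiltant2008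
Prop. 4.2; Hironaka1967; Moh1987.) -/
def SeqVSpecCurveReg (n : ℕ) : Prop :=
  ∀ p : ℕ, p.Prime → ∀ (k : Type) [Field k] [CharP k p]
    (Y : Scheme.{0}) (g : Y ⟶ Spec (.of k)), IsSeparated g → LocallyOfFiniteType g → QuasiCompact g →
    ∀ hY : Scheme.IsRegular Y, topologicalKrullDim Y ≤ 4 →
    ∀ I : Y.IdealSheafData, (∀ y : Y, idealOrder I y ≤ ((n : ℕ) : ℕ∞)) →
      (∃ y : Y, idealOrder I y = ((n : ℕ) : ℕ∞) ∧ IsVastSpecialPt g hY I n y ∧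
        ¬ FaceFormCutClasses.IsIsolatedTop I n y ∧ OnRegularCleanCurve I n y) →
      ∃ t : CentreSeq Y, WeakResolution t (⟨I, [], n⟩ : MarkedIdeal Y)

/-- `SeqVSpecCurveSing n` — SINGULAR-CENTRE sub-stratum (g14's, with vast-special points): non-isolated vast-special core
top points on clean curves exist and NONE of them lies on a clean curve regular at it (`HauserE7`: the cusp `(t², t³)`;
`Narasimhan`: `(t³², t⁷, t¹⁹, t¹⁵)`).  [UNDECIDED · INSTRUMENTED (T-singular-followup) · Round / TANGLE material after
rounds.] (Sources: Narasimhan1983; Hauser2010; CossartJannsenSaito2020 Ch. 5.) -/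
def SeqVSpecCurveSing (n : ℕ) : Prop :=
  ∀ p : ℕ, p.Prime → ∀ (k : Type) [Field k] [CharP k p]
    (Y : Scheme.{0}) (g : Y ⟶ Spec (.of k)), IsSeparated g → LocallyOfFiniteType g → QuasiCompact g →
    ∀ hY : Scheme.IsRegular Y, topologicalKrullDim Y ≤ 4 →
    ∀ I : Y.IdealSheafData, (∀ y : Y, idealOrder I y ≤ ((n : ℕ) : ℕ∞)) →
      (∃ y : Y, idealOrder I y = ((n : ℕ) : ℕ∞) ∧ IsVastSpecialPt g hY I n y ∧
        ¬ FaceFormCutClasses.IsIsolatedTop I n y ∧ OnCleanCurve I n y) →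
      (∀ y : Y, idealOrder I y = ((n : ℕ) : ℕ∞) → IsVastSpecialPt g hY I n y →
        ¬ FaceFormCutClasses.IsIsolatedTop I n y → OnCleanCurve I n y → ¬ OnRegularCleanCurve I n y) →
      ∃ t : CentreSeq Y, WeakResolution t (⟨I, [], n⟩ : MarkedIdeal Y)

/-- `VGenRungAt n` — the decided rung at one marking: `SeqDimFour 2 n → SeqVGen n`.  [DECIDED-MOD-PORT, `n ≥ 2`:
`vGenRungAt_of_engines`; `n = 1`: `vGenRungAt_one`.] -/
def VGenRungAt (n : ℕ) : Prop := SeqDimFour 2 n → SeqVGen n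

/-- **`VastGenericRung`** — the DECIDED half of `RungOne`: `E 2 →` weak order reduction for every marking and all data
whose core top points are near-generic, δ-generic, curve-generic, rel-curve-generic, flat-curve, pinch-curve, cone-curve
or vast-curve points.  [WEAKER · DECIDED-MOD-PORT(M+): `vastGenericRung_of_engines`.]  STATEMENT (decided piece).
(Sources: CossartPiltant2008 Prop. 4.2; Hironaka1967; CossartJannsenSaito2020 Ch. 2, Ch. 8.) -/
def VastGenericRung : Prop := E 2 → ∀ n : ℕ, 1 ≤ n → SeqVGen n

/-- **`VastSpecialRung`** — THE LOCATED RESIDUAL of this node: `E 2 →` weak order reduction for every marking and all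
data with a vast-special core top point.  [WEAKER BY LETTER · UNDECIDED · IDEA-NEEDED · cofinal ⇒ score 0.]
STATEMENT (located residual). (Sources: CossartPiltant2019 Rem. 3.2; Moh1987; Giraud1975; Narasimhan1983.) -/
def VastSpecialRung : Prop := E 2 → ∀ n : ℕ, 1 ≤ n → SeqVSpec n

section Kernels

variable {n : ℕ}

/-! ### §NK  Kernels of the VAST cut — pure logic (0 sorry; mechanical copy of §K) -/

/-- Pointwise EXHAUSTION: a top point is of class ≥ 2, near-generic, δ-generic, curve-generic, rel-curve-generic,
flat-curve, pinch-curve, cone-curve or vast-curve — or vast-special. [folklore] -/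
theorem classGE_or_gen_or_wspecial {k : Type} [Field k] {Y : Scheme.{0}} (g : Y ⟶ Spec (.of k))
    (hY : Scheme.IsRegular Y) (I : Y.IdealSheafData) (n : ℕ) (y : Y) :
    (ClassGE g hY I n 2 y ∨ VeryNearCutClasses.IsNearGenericPt I n y ∨ IsDeltaGenericPt I n y ∨
        IsCurveGenericPt I n y ∨ IsRelCurveGenericPt I n y ∨ IsFlatCurvePt I n y ∨
        IsPinchCurvePt I n y ∨ IsConeCurvePt I n y ∨ IsVastCurvePt I n y) ∨
      IsVastSpecialPt g hY I n y := by
  rcases PinchCut.classGE_or_gen_or_pspecial g hY I n y with h | h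
  · rcases h with h | h | h | h | h | h | h | h
    · exact Or.inl (Or.inl h)
    · exact Or.inl (Or.inr (Or.inl h))
    · exact Or.inl (Or.inr (Or.inr (Or.inl h)))
    · exact Or.inl (Or.inr (Or.inr (Or.inr (Or.inl h))))
    · exact Or.inl (Or.inr (Or.inr (Or.inr (Or.inr (Or.inl h)))))
    · exact Or.inl (Or.inr (Or.inr (Or.inr (Or.inr (Or.inr (Or.inl h))))))
    · exact Or.inl (Or.inr (Or.inr (Or.inr (Or.inr (Or.inr (Or.inr (Or.inl h)))))))
    · exact Or.inl (Or.inr (Or.inr (Or.inr (Or.inr (Or.inr (Or.inr (Or.inr (Or.inl h))))))))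
  · by_cases h9 : IsVastCurvePt I n y
    · exact Or.inl (Or.inr (Or.inr (Or.inr (Or.inr (Or.inr (Or.inr (Or.inr (Or.inr h9))))))))
    · exact Or.inr ⟨h, h9⟩

end Kernels

end Vast

end Summit.ResolutionOfSingularities.ResolutionOfSingularities.Theorems.JetCut
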